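import Summits.ValiantsHypothesis.ValiantsHypothesis.Theorems.LacunarySymmetroidMatrixDescartesFirstRung

/-!
# Crux `DerivedPencilRolleQuasi` (stmt-ValiantsHypothesis-18064), line `Sketch` — stub `stub_loewner_rung`

The calibration rung of card `monotone-freezing` (Loewner / PSD sector): a SYMMETRIC head `T₀` plus a
positive semidefinite lacunary tail `∑ₗ X^{dₗ} • Tₗ` has a determinant with at most `k` distinct positive
real zeros.  This is the `e = 0` instance of the tree theorem
`LacunarySymmetroidMatrixDescartes.firstRung_low` (sibling crux `MatrixDescartes`, line `Lift`: inertia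
chain + kernel data), so the proof is a rewrite `T₀.map C = X^0 • T₀.map C`.  The hypotheses `0 < d l` and
`det ≠ 0` of the registered signature are not needed and are kept only because the signature is registered
verbatim.
-/

-- single-conjunct layout: Sub = Summit, duplicated namespace component intended
set_option linter.dupNamespace false

namespace Summit.ValiantsHypothesis.ValiantsHypothesis.Theorems.SymmetroidDescartes.DerivedPencilRolleQuasiSketch

open Polynomial Matrix Finset
open scoped BigOperators

/-- **Registered stub `stub_loewner_rung`** (line `Sketch` of crux stmt-ValiantsHypothesis-18064): for a real
symmetric `T₀` and positive semidefinite `T l`, the determinant of `T₀ + ∑ₗ X^{d l} • T l` has at most `k`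
distinct positive real roots (Loewner monotonicity on `(0,∞)`; negative-index counting).  Immediate from
`LacunarySymmetroidMatrixDescartes.firstRung_low` with pivot exponent `e = 0`. -/
theorem stub_loewner_rung (k K : ℕ) (T₀ : Matrix (Fin k) (Fin k) ℝ) (hT₀ : T₀.IsSymm)
    (T : Fin K → Matrix (Fin k) (Fin k) ℝ) (hT : ∀ l, (T l).PosSemidef) (d : Fin K → ℕ) (_hd : ∀ l, 0 < d l)
    (_hne : (T₀.map C + ∑ l, (X : ℝ[X]) ^ d l • (T l).map C).det ≠ 0) :
    ((T₀.map C + ∑ l, (X : ℝ[X]) ^ d l • (T l).map C).det.roots.toFinset.filter (fun t => 0 < t)).card ≤ k := by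
  have h := Summit.ValiantsHypothesis.ValiantsHypothesis.Theorems.LacunarySymmetroidMatrixDescartes.firstRung_low
    (Fin k) (Fin K) 0 d T₀ T hT₀ hT (fun l => Nat.zero_le _)
  simpa only [pow_zero, one_smul, Fintype.card_fin] using h

end Summit.ValiantsHypothesis.ValiantsHypothesis.Theorems.SymmetroidDescartes.DerivedPencilRolleQuasiSketch
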